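import Summits.AtomisticToContinuum.Crystallization.Theses.ChessboardParticlePlanes
import Literature.MathematicalPhysics.StatisticalMechanics.PeriodicConfigurationSums

/-!
# Crux `ChessboardParticlePlanes.LjPlaneChessboard` (stmt-AtomisticToContinuum-6709), line `Sketch`,
# stub `siteSum_heightSplit` — a Lennard-Jones site sum splits over the particle planes

Let `P` be a periodic configuration of `ℝ³`, `x` a point, and `H : ℤ → ℝ` a strictly increasing
enumeration of heights such that every point `y` of `P` has height `y 2 = H i` for some `i : ℤ`.
Then (i) for each `i` the Lennard-Jones site sum over the points of `P` at height `H i` (the point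
`x` excluded) is summable, (ii) the family of these layer sums is summable over `i : ℤ`, and (iii)
`∑'_{y ∈ P.points, y ≠ x} V_LJ(|x - y|) = ∑'_i ∑'_{y ∈ P.points, y 2 = H i, y ≠ x} V_LJ(|x - y|)`.
[folklore]

PROOF.  The layer index `i` of a point is unique (`StrictMono.injective`), so `y ↦ ⟨i(y), y⟩` is
an `Equiv` between the punctured point set `{y // y ∈ P.points ∧ y ≠ x}` and the sigma type
`Σ i : ℤ, {y // y ∈ P.points ∧ y 2 = H i ∧ y ≠ x}` of the punctured layers.  The Lennard-Jones
site sum of a periodic configuration of `ℝ³` is (unconditionally, i.e. absolutely) summable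
(`PeriodicConfiguration.summable_lennardJones_dist_three`); transported along the `Equiv`
(`Equiv.summable_iff`, `Equiv.tsum_eq`) it is a summable family on the sigma type, so — `ℝ`
being complete — each fibre is summable (`Summable.sigma_factor`), the fibre sums form a summable
family (`Summable.sigma`), and the total is the iterated sum (`Summable.tsum_sigma`).

No definition and no notation is introduced.
-/

noncomputable section

namespace Summit.AtomisticToContinuum.Crystallization.Theorems.ChessboardParticlePlanesLjPlaneChessboard

open Literature.MathematicalPhysics.StatisticalMechanics

/-- **A Lennard-Jones site sum splits over the particle planes.**  For a periodic configuration
`P` of `ℝ³`, a point `x`, and a strictly increasing `H : ℤ → ℝ` such that every point of `P` has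
height `H i` for some `i`: every punctured layer sum `∑'_{y ∈ P.points, y 2 = H i, y ≠ x} V_LJ(|x - y|)`
is summable, the layer sums are summable over `i : ℤ`, and the punctured site sum
`∑'_{y ∈ P.points, y ≠ x} V_LJ(|x - y|)` is the sum over `i` of the layer sums (reindex the
absolutely summable site sum by the sigma type of the layers; `Summable.tsum_sigma`). [folklore] -/
theorem siteSum_heightSplit :
    ∀ (P : PeriodicConfiguration 3) (x : EuclideanSpace ℝ (Fin 3)) (H : ℤ → ℝ), StrictMono H →
      (∀ y ∈ P.points, ∃ i : ℤ, y 2 = H i) →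
      (∀ i : ℤ, Summable (fun y : {y : EuclideanSpace ℝ (Fin 3) // y ∈ P.points ∧ y 2 = H i ∧ y ≠ x} =>
          lennardJones (dist x y.1))) ∧
      Summable (fun i : ℤ => ∑' y : {y : EuclideanSpace ℝ (Fin 3) // y ∈ P.points ∧ y 2 = H i ∧ y ≠ x},
          lennardJones (dist x y.1)) ∧
      ∑' y : {y : EuclideanSpace ℝ (Fin 3) // y ∈ P.points ∧ y ≠ x}, lennardJones (dist x y.1) =
        ∑' i : ℤ, ∑' y : {y : EuclideanSpace ℝ (Fin 3) // y ∈ P.points ∧ y 2 = H i ∧ y ≠ x},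
          lennardJones (dist x y.1) := by
  intro P x H hH hcov
  choose idx hidx using hcov
  -- the punctured layers `T i`, and the reindexing `e` of the punctured point set by them
  let T : ℤ → Type := fun i =>
    {y : EuclideanSpace ℝ (Fin 3) // y ∈ P.points ∧ y 2 = H i ∧ y ≠ x}
  let e : {y : EuclideanSpace ℝ (Fin 3) // y ∈ P.points ∧ y ≠ x} ≃ Σ i, T i :=
    { toFun := fun y => ⟨idx y.1 y.2.1, ⟨y.1, y.2.1, hidx y.1 y.2.1, y.2.2⟩⟩
      invFun := fun p => ⟨p.2.1, p.2.2.1, p.2.2.2.2⟩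
      left_inv := fun _ => rfl
      right_inv := fun p => by
        obtain ⟨i, y⟩ := p
        have hi : idx y.1 y.2.1 = i := hH.injective ((hidx y.1 y.2.1).symm.trans y.2.2.1)
        exact Sigma.subtype_ext hi rfl }
  -- the site sum, reindexed by (layer, point), is summable: split it over the layers
  let f : (Σ i, T i) → ℝ := fun p => lennardJones (dist x p.2.1)
  have hf : Summable f := e.summable_iff.1 (P.summable_lennardJones_dist_three x)
  refine ⟨fun i => hf.sigma_factor i, hf.sigma, ?_⟩
  calc ∑' y : {y : EuclideanSpace ℝ (Fin 3) // y ∈ P.points ∧ y ≠ x}, lennardJones (dist x y.1)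
      = ∑' y, f (e y) := rfl
    _ = ∑' p, f p := e.tsum_eq f
    _ = ∑' i, ∑' y : T i, f ⟨i, y⟩ := hf.tsum_sigma

end Summit.AtomisticToContinuum.Crystallization.Theorems.ChessboardParticlePlanesLjPlaneChessboard

end
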